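import Summits.BirchSwinnertonDyer.BirchSwinnertonDyer.Theorems.SignedBaseChangeAnticyclotomicEisensteinDivisibilityAdmdefRootVisibleOfUnitLambda
import HarnessLib

/-!
# Line `admdef` on the crux `AnticyclotomicEisensteinDivisibility` (stmt-BirchSwinnertonDyer-20727), LEAD gen 25:
# ONE-STEP PROPAGATION of Howard's rigidity at the bottom layer, at an ARBITRARY vertex — both reciprocity laws of a signed
# bipartite system read as EQUIVALENCES «`λ` is a unit at the neighbouring definite vertex ⟺ `κ` is visible at `q`» modulo `𝔪 = (p, T)`

Lead seat bsd-line-sbc-p1 (gen 25), `--supports stmt-BirchSwinnertonDyer-20727`.  LEAD g19 (`…AdmdefUnitLambdaOfLoc`) read the two laws of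
a signed bipartite system `B` (CHKLL25 Thm. 7.4 as typed, `IsSignedBipartiteSystem`) at the bottom layer in the direction «visible ⟹ unit»:
`unrLoc_φ(κ_1(m))_0 ≠ 0 ⟹ λ_1(mq)(0) ∈ ℤ_pˣ` (second law) and `ordLoc_𝔓(κ_1(nq))_0 ≠ 0 ⟹ λ_1(n)(0) ∈ ℤ_pˣ` (first law), at EVERY vertex;
LEAD g24 (`…AdmdefRootVisibleOfUnitLambda`) proved the converse of the second law AT THE ROOT (`m = 1`) given a non-zero element of the local
target `H¹(⟨φ⟩, E[p])`.  THIS FILE completes the picture at an ARBITRARY vertex: the converses of BOTH laws given a non-zero element of the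
respective local target (for the first law: a non-zero element of the ordinary line `ordLine 𝔓`), hence the two EQUIVALENCES that drive every
step of Howard's rigidity induction ([Howard2006] Lem. 2.3.3–2.3.4 / Thm. 3.2.3; [BurungaleCastellaKim2021] Lem. 7.3; W. Zhang's triangulation):
* up an edge from an indefinite vertex `m` to the definite vertex `mq`: `λ_1(mq)(0)` unit ⟺ `κ_1(m)_0` visible at `q` (at `⟨φ⟩`);
* up an edge from a definite vertex `n` to the indefinite vertex `nq`: `λ_1(n)(0)` unit ⟺ `κ_1(nq)_0` has non-zero ordinary coordinate at `q`.
What remains for the full rigidity theorem (NOT done here): the Selmer-side parity lemma at a general vertex in the bipartite currency (the tree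
has it in the AKR walk currency `SelQP`, `…AdmdefSignedDetour`), the two-class Čebotarev lemma, and the merge induction — see
`Lines/admdef-lead-g25.md` §3.

* §1 `isCoinducedIn_delta_of_mem` — the delta family of `u ∈ B` is coinduced IN `B` (`u ⊗ 1 ∈ B ⊗ Λ`; from g24's `isCoinducedIn_delta`);
  `ordLoc_apply_zero` — the ordinary coordinate at `a = 0` is plain restriction to `I_𝔓 ∩ Gal(K̄/K_∞)`.
* §2 (second law, converse, any `m`) `unrLoc_kappa_ne_zero_of_isUnit_lam` / `res_kappa_layer_zero_ne_zero_of_isUnit_lam` /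
  `kappa_layer_zero_ne_zero_of_isUnit_lam_mul` — `mq ∈ 𝒩_1^def`, `q ∤ m`, `φ ∈ D_𝔓 ∩ Gal(K̄/K_∞)` arithmetic Frobenius over `q`, a non-zero
  `u ∈ H¹(⟨φ⟩, E[p])`, `λ_1(mq)(0) ∈ ℤ_pˣ` ⟹ `res_{⟨φ⟩}(κ_1(m)_0) ≠ 0`, so `κ_1(m)_0 ≠ 0`; and the iff `isUnit_lam_mul_iff_res_kappa_ne_zero`.
* §3 (first law, converse) `ordLoc_kappa_ne_zero_of_isUnit_lam` / `kappa_mul_layer_zero_ne_zero_of_isUnit_lam` — `nq ∈ 𝒩_1^ind`, `q ∤ n`,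
  `𝔓 ∣ v ∋ q`, a non-zero `w ∈ ordLine 𝔓 ⊆ H¹(I_𝔓 ∩ Gal(K̄/K_∞), E[p])`, `λ_1(n)(0) ∈ ℤ_pˣ` ⟹ `ordLoc_𝔓(κ_1(nq))_0(0) ≠ 0`, so `κ_1(nq)_0 ≠ 0`;
  and the iff `isUnit_lam_iff_ordLoc_kappa_ne_zero`.

Honest framing: theorems only (0 definitions, 0 named facts, 0 `sorry`, standard axioms); nothing is closed; the local witnesses `u`, `w` are
hypotheses (in print `H¹_unr(K_q, E[p]) ≅ H¹_ord(K_q, E[p]) ≅ 𝔽_p` for admissible `q`, [Howard2006] Lem. 2.2.1 — in the tree a non-zero element is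
available as the restriction of a visible global class, `…AdmdefRootZero`).  BSD / the crux / (RV₁)H / the anchors are NOT proved by this file.

## References
* [CastellaEtAl2025] arXiv:2308.10474v2, Thm. 7.4 (the two laws, p. 30 L44–L52), (7.2), Thm. 7.5.
* [Howard2006] B. Howard, *Bipartite Euler systems*, J. reine angew. Math. 597 (2006): Lem. 2.2.1, Lem. 2.3.3–2.3.4, Lem. 3.1.2, §3.2 (15), Thm. 3.2.3.
* [BurungaleCastellaKim2021] arXiv:1908.09512, Lem. 7.3, Prop. 7.4, Lem. 7.6.
* [WZhang2014] Camb. J. Math. 2 (2014), §5 (5.1), proof of Thm. 9.1.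
-/

-- D-0017: single-problem summit, the namespace repeats the problem name by design.
set_option linter.dupNamespace false
set_option autoImplicit false

noncomputable section

open scoped Classical

open NumberField IsDedekindDomain Field
open Literature.NumberTheory.EllipticCurves Literature.NumberTheory.GaloisRepresentations
open Literature.NumberTheory.EllipticCurves.IwasawaDual
open Literature.NumberTheory.EllipticCurves.BertoliniDarmon2005
open Literature.NumberTheory.EllipticCurves.CastellaHsuKunduLeeLiu2025
open WeierstrassCurve (geomTorsion)
open Summit.BirchSwinnertonDyer.BirchSwinnertonDyer.Theorems.SignedBaseChangeAcDivAdmdefUnitLambdaOfLoc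
open Summit.BirchSwinnertonDyer.BirchSwinnertonDyer.Theorems.SignedBaseChangeAcDivAdmdefRootVisibleOfUnitLambda

namespace Summit.BirchSwinnertonDyer.BirchSwinnertonDyer.Theorems.SignedBaseChangeAcDivAdmdefBipartitePropagation

universe u

/-! ## §1 Delta families inside a subgroup; the ordinary coordinate at `a = 0` -/

section Prelim

variable (p : ℕ) [Fact p.Prime] {U : Type*} [AddCommGroup U]

/-- **The delta family of `u ∈ B` is coinduced IN `B`**: `a ↦ [a = 0]·u` has values in `B` (and `0 ∈ B`) and satisfies the trace relations
(g24's `isCoinducedIn_delta`) — the element `u ⊗ 1` of `B ⊗ Λ`. [cite: Howard2006, Lem. 3.1.2 (the coinduced module)] -/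
theorem isCoinducedIn_delta_of_mem {B : AddSubgroup U} {u : U} (hu : u ∈ B) :
    IsCoinducedIn p B (fun _ a ↦ if a = 0 then u else 0) := by
  refine ⟨fun n a ↦ ?_, (isCoinducedIn_delta p u).2⟩
  show (if a = 0 then u else 0) ∈ B
  by_cases ha : a = 0
  · rw [if_pos ha]; exact hu
  · rw [if_neg ha]; exact B.zero_mem

end Prelim

section OrdZero

variable {K : Type} [Field K] [NumberField K] {W : WeierstrassCurve ℚ} {p : ℕ} [Fact p.Prime]
  {κ : ZpExtension K p} {γ : absoluteGaloisGroup K}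

/-- The ordinary coordinate at `a = 0` is plain restriction: `ordLoc … 𝔓 x n 0 = res_{I_𝔓 ∩ Gal(K̄/K_∞)}(x_n)` (conjugation by `γ⁰ = 1` is the
identity on `H¹`). [cite: Howard2006, Lem. 3.1.2] -/
theorem ordLoc_apply_zero {j n : ℕ} (𝔓 : Ideal (absIntegers (𝓞 K) K))
    (x : Π n : ℕ, (W.baseChange K).torsionH1Over ((p : ℤ) ^ j) (κ.layerSubgroup n)) :
    ordLoc (W.baseChange K) p κ γ j 𝔓 x n 0 = resOfLe (geomTorsion (W.baseChange K) ((p : ℤ) ^ j))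
      (inf_le_right.trans (κ.kerSubgroup_le_layerSubgroup n)) (x n) := by
  rw [ordLoc_apply, ZMod.val_zero, pow_zero, inv_one, conjH1_one_holds, AddMonoidHom.id_apply]

end OrdZero

/-! ## §2 Second law, converse direction, at an arbitrary indefinite vertex `m` -/

section SecondLaw

variable {K : Type} [Field K] [NumberField K] {W : WeierstrassCurve ℚ} [W.IsGloballyMinimal] {p : ℕ} [Fact p.Prime]
  {κ : ZpExtension K p} {γ : absoluteGaloisGroup K} {N : ℕ} {ε : ℤˣ} {B : SignedBipartiteSystem W K p κ}

/-- **Second law, converse, at any vertex: a unit `λ_1(mq)(0)` makes `κ_1(m)` VISIBLE at `q`.**  For `mq ∈ 𝒩_1^def` with `q` a `1`-admissible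
prime not dividing `m`, a prime `𝔓 ∣ v ∋ q` of `K̄`, an arithmetic Frobenius `φ ∈ D_𝔓 ∩ Gal(K̄/K_∞)`, a NON-ZERO `u ∈ H¹(⟨φ⟩, E[p])`: if
`λ_1(mq)(0) ∈ ℤ_pˣ` then the unramified coordinate of `κ_1(m)` at `φ` is non-zero at the bottom layer, `unrLoc_φ(κ_1(m))_0(0) ≠ 0`.  The law
«`Λ·unrLoc_φ(κ_1(m)) = λ_1(mq)·{coinduced families}`» applied to the delta family of `u` (`layer_zero_ne_zero_of_spanEqSmul_of_isUnit`).  At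
`m = 1` this is g24's `res_kappa_one_ne_zero_of_isUnit_lam`.  Converse of g19's `isUnit_constantCoeff_lam_of_unrLoc_ne_zero`.
[cite: CastellaEtAl2025, Thm. 7.4, second law (arXiv:2308.10474v2 p0030 L50–L52)] [cite: Howard2006, §3.2 (15), Lem. 2.3.3] -/
theorem unrLoc_kappa_ne_zero_of_isUnit_lam (hB : IsSignedBipartiteSystem W K p κ γ N ε B) {m q : ℕ}
    (hmq : m * q ∈ defProducts N K (fun ℓ ↦ W.frobeniusTrace ℓ) p 1)
    (hq : IsAdmissiblePrime N K (fun ℓ ↦ W.frobeniusTrace ℓ) p 1 q) (hqm : ¬ q ∣ m)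
    {v : HeightOneSpectrum (𝓞 K)} (hv : ((q : ℕ) : 𝓞 K) ∈ v.asIdeal) {𝔓 : Ideal (absIntegers (𝓞 K) K)}
    (h𝔓 : 𝔓 ∈ v.primesAbove) {φ : absoluteGaloisGroup K} (hφ : φ ∈ κ.kerSubgroup)
    (hφD : φ ∈ 𝔓.decompositionSubgroup (absoluteGaloisGroup K)) (hφF : IsArithFrobAt (𝓞 K) φ 𝔓)
    (u : (W.baseChange K).torsionH1Over ((p : ℤ) ^ 1) (Subgroup.zpowers φ)) (hu : u ≠ 0)
    (hlam : IsUnit (PowerSeries.constantCoeff (B.lam 1 (m * q)))) :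
    unrLoc (W.baseChange K) p κ γ 1 hφ (B.kappa 1 m) 0 0 ≠ 0 :=
  layer_zero_ne_zero_of_spanEqSmul_of_isUnit p (hB.second_law 1 m q one_pos hmq hq hqm v hv 𝔓 h𝔓 φ hφ hφD hφF)
    (fun w ↦ nsmul_torsionH1Over_pow_one_eq_zero (W.baseChange K) p (Subgroup.zpowers φ) w) hlam
    (isCoinducedIn_delta p u) (by simpa using hu)

/-- **Hence `res_{⟨φ⟩}(κ_1(m)_0) ≠ 0`** (the unramified coordinate at `a = 0` is plain restriction). [cite: CastellaEtAl2025, Thm. 7.4 second law]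
[cite: Howard2006, Lem. 2.3.3] -/
theorem res_kappa_layer_zero_ne_zero_of_isUnit_lam (hB : IsSignedBipartiteSystem W K p κ γ N ε B) {m q : ℕ}
    (hmq : m * q ∈ defProducts N K (fun ℓ ↦ W.frobeniusTrace ℓ) p 1)
    (hq : IsAdmissiblePrime N K (fun ℓ ↦ W.frobeniusTrace ℓ) p 1 q) (hqm : ¬ q ∣ m)
    {v : HeightOneSpectrum (𝓞 K)} (hv : ((q : ℕ) : 𝓞 K) ∈ v.asIdeal) {𝔓 : Ideal (absIntegers (𝓞 K) K)}
    (h𝔓 : 𝔓 ∈ v.primesAbove) {φ : absoluteGaloisGroup K} (hφ : φ ∈ κ.kerSubgroup)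
    (hφD : φ ∈ 𝔓.decompositionSubgroup (absoluteGaloisGroup K)) (hφF : IsArithFrobAt (𝓞 K) φ 𝔓)
    (u : (W.baseChange K).torsionH1Over ((p : ℤ) ^ 1) (Subgroup.zpowers φ)) (hu : u ≠ 0)
    (hlam : IsUnit (PowerSeries.constantCoeff (B.lam 1 (m * q)))) :
    resOfLe (geomTorsion (W.baseChange K) ((p : ℤ) ^ 1))
      ((Subgroup.zpowers_le.mpr hφ).trans (κ.kerSubgroup_le_layerSubgroup 0)) (B.kappa 1 m 0) ≠ 0 := by
  have h := unrLoc_kappa_ne_zero_of_isUnit_lam hB hmq hq hqm hv h𝔓 hφ hφD hφF u hu hlam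
  rwa [unrLoc_apply_zero] at h

/-- **Hence the bottom class `κ_1(m)_0 ∈ H¹(K, E[p])` is NON-ZERO** — «a unit at the definite vertex `mq` propagates DOWN the edge to the
indefinite vertex `m`» (Howard's descent step; at `m = 1`, g24's `kappa_one_layer_zero_ne_zero_of_isUnit_lam`).
[cite: Howard2006, Lem. 2.3.3, Thm. 3.2.3] [cite: BurungaleCastellaKim2021, arXiv:1908.09512 Lem. 7.3] -/
theorem kappa_layer_zero_ne_zero_of_isUnit_lam_mul (hB : IsSignedBipartiteSystem W K p κ γ N ε B) {m q : ℕ}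
    (hmq : m * q ∈ defProducts N K (fun ℓ ↦ W.frobeniusTrace ℓ) p 1)
    (hq : IsAdmissiblePrime N K (fun ℓ ↦ W.frobeniusTrace ℓ) p 1 q) (hqm : ¬ q ∣ m)
    {v : HeightOneSpectrum (𝓞 K)} (hv : ((q : ℕ) : 𝓞 K) ∈ v.asIdeal) {𝔓 : Ideal (absIntegers (𝓞 K) K)}
    (h𝔓 : 𝔓 ∈ v.primesAbove) {φ : absoluteGaloisGroup K} (hφ : φ ∈ κ.kerSubgroup)
    (hφD : φ ∈ 𝔓.decompositionSubgroup (absoluteGaloisGroup K)) (hφF : IsArithFrobAt (𝓞 K) φ 𝔓)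
    (u : (W.baseChange K).torsionH1Over ((p : ℤ) ^ 1) (Subgroup.zpowers φ)) (hu : u ≠ 0)
    (hlam : IsUnit (PowerSeries.constantCoeff (B.lam 1 (m * q)))) : B.kappa 1 m 0 ≠ 0 := by
  intro h0
  apply res_kappa_layer_zero_ne_zero_of_isUnit_lam hB hmq hq hqm hv h𝔓 hφ hφD hφF u hu hlam
  rw [h0, map_zero]

/-- **The edge `m — mq` read both ways: `λ_1(mq)(0) ∈ ℤ_pˣ ⟺ res_{⟨φ⟩}(κ_1(m)_0) ≠ 0`** (given a non-zero element of `H¹(⟨φ⟩, E[p])`):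
g19's `isUnit_constantCoeff_lam_of_unrLoc_ne_zero` and §2.  Howard's dichotomy at a definite vertex adjacent to `m`, modulo `𝔪`.
[cite: Howard2006, Lem. 2.3.3, Thm. 3.2.3 (c)] [cite: CastellaEtAl2025, Thm. 7.4 second law] -/
theorem isUnit_lam_mul_iff_res_kappa_ne_zero (hB : IsSignedBipartiteSystem W K p κ γ N ε B) {m q : ℕ}
    (hmq : m * q ∈ defProducts N K (fun ℓ ↦ W.frobeniusTrace ℓ) p 1)
    (hq : IsAdmissiblePrime N K (fun ℓ ↦ W.frobeniusTrace ℓ) p 1 q) (hqm : ¬ q ∣ m)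
    {v : HeightOneSpectrum (𝓞 K)} (hv : ((q : ℕ) : 𝓞 K) ∈ v.asIdeal) {𝔓 : Ideal (absIntegers (𝓞 K) K)}
    (h𝔓 : 𝔓 ∈ v.primesAbove) {φ : absoluteGaloisGroup K} (hφ : φ ∈ κ.kerSubgroup)
    (hφD : φ ∈ 𝔓.decompositionSubgroup (absoluteGaloisGroup K)) (hφF : IsArithFrobAt (𝓞 K) φ 𝔓)
    (u : (W.baseChange K).torsionH1Over ((p : ℤ) ^ 1) (Subgroup.zpowers φ)) (hu : u ≠ 0) :
    IsUnit (PowerSeries.constantCoeff (B.lam 1 (m * q))) ↔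
      resOfLe (geomTorsion (W.baseChange K) ((p : ℤ) ^ 1))
        ((Subgroup.zpowers_le.mpr hφ).trans (κ.kerSubgroup_le_layerSubgroup 0)) (B.kappa 1 m 0) ≠ 0 := by
  refine ⟨res_kappa_layer_zero_ne_zero_of_isUnit_lam hB hmq hq hqm hv h𝔓 hφ hφD hφF u hu, fun hne ↦ ?_⟩
  refine isUnit_constantCoeff_lam_of_unrLoc_ne_zero hB hmq hq hqm hv h𝔓 hφ hφD hφF (a := 0) ?_
  rwa [unrLoc_apply_zero]

end SecondLaw

/-! ## §3 First law, converse direction, at an arbitrary definite vertex `n` -/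

section FirstLaw

variable {K : Type} [Field K] [NumberField K] {W : WeierstrassCurve ℚ} [W.IsGloballyMinimal] {p : ℕ} [Fact p.Prime]
  {κ : ZpExtension K p} {γ : absoluteGaloisGroup K} {N : ℕ} {ε : ℤˣ} {B : SignedBipartiteSystem W K p κ}

/-- **First law, converse, at any vertex: a unit `λ_1(n)(0)` gives `κ_1(nq)` a NON-ZERO ORDINARY coordinate at `q`.**  For `nq ∈ 𝒩_1^ind`
with `q` a `1`-admissible prime not dividing `n`, a prime `𝔓 ∣ v ∋ q` of `K̄`, a NON-ZERO element `w` of the ordinary line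
`ordLine 𝔓 ⊆ H¹(I_𝔓 ∩ Gal(K̄/K_∞), E[p])` (in print `H¹_ord(K_q, E[p]) ≅ 𝔽_p`, [Howard2006] Lem. 2.2.1): if `λ_1(n)(0) ∈ ℤ_pˣ` then
`ordLoc_𝔓(κ_1(nq))_0(0) ≠ 0`.  The law «`Λ·ordLoc_𝔓(κ_1(nq)) = λ_1(n)·{coinduced families in ordLine 𝔓}`» applied to the delta family of `w`
(`isCoinducedIn_delta_of_mem`).  Converse of g19's `isUnit_constantCoeff_lam_of_ordLoc_ne_zero`.
[cite: CastellaEtAl2025, Thm. 7.4, first law (arXiv:2308.10474v2 p0030 L46–L49)] [cite: Howard2006, §3.2 (15), Lem. 2.3.4] -/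
theorem ordLoc_kappa_ne_zero_of_isUnit_lam (hB : IsSignedBipartiteSystem W K p κ γ N ε B) {n q : ℕ}
    (hnq : n * q ∈ indefProducts N K (fun ℓ ↦ W.frobeniusTrace ℓ) p 1)
    (hq : IsAdmissiblePrime N K (fun ℓ ↦ W.frobeniusTrace ℓ) p 1 q) (hqn : ¬ q ∣ n)
    {v : HeightOneSpectrum (𝓞 K)} (hv : ((q : ℕ) : 𝓞 K) ∈ v.asIdeal) {𝔓 : Ideal (absIntegers (𝓞 K) K)}
    (h𝔓 : 𝔓 ∈ v.primesAbove)
    {w : subgroupH1 (𝔓.inertia (absoluteGaloisGroup K) ⊓ κ.kerSubgroup) (geomTorsion (W.baseChange K) ((p : ℤ) ^ 1))}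
    (hw : w ∈ ordLine (W.baseChange K) p κ 1 𝔓) (hw0 : w ≠ 0)
    (hlam : IsUnit (PowerSeries.constantCoeff (B.lam 1 n))) :
    ordLoc (W.baseChange K) p κ γ 1 𝔓 (B.kappa 1 (n * q)) 0 0 ≠ 0 :=
  layer_zero_ne_zero_of_spanEqSmul_of_isUnit p (hB.first_law 1 n q one_pos hnq hq hqn v hv 𝔓 h𝔓)
    (fun x ↦ nsmul_torsionH1Over_pow_one_eq_zero (W.baseChange K) p _ x) hlam
    (isCoinducedIn_delta_of_mem p hw) (by simpa using hw0)

/-- **Hence the bottom class `κ_1(nq)_0 ∈ H¹(K, E[p])` is NON-ZERO** — «a unit at the definite vertex `n` propagates UP the edge to the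
indefinite vertex `nq`» (Howard's ascent step). [cite: Howard2006, Lem. 2.3.4, Thm. 3.2.3] [cite: BurungaleCastellaKim2021, arXiv:1908.09512 Lem. 7.3] -/
theorem kappa_mul_layer_zero_ne_zero_of_isUnit_lam (hB : IsSignedBipartiteSystem W K p κ γ N ε B) {n q : ℕ}
    (hnq : n * q ∈ indefProducts N K (fun ℓ ↦ W.frobeniusTrace ℓ) p 1)
    (hq : IsAdmissiblePrime N K (fun ℓ ↦ W.frobeniusTrace ℓ) p 1 q) (hqn : ¬ q ∣ n)
    {v : HeightOneSpectrum (𝓞 K)} (hv : ((q : ℕ) : 𝓞 K) ∈ v.asIdeal) {𝔓 : Ideal (absIntegers (𝓞 K) K)}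
    (h𝔓 : 𝔓 ∈ v.primesAbove)
    {w : subgroupH1 (𝔓.inertia (absoluteGaloisGroup K) ⊓ κ.kerSubgroup) (geomTorsion (W.baseChange K) ((p : ℤ) ^ 1))}
    (hw : w ∈ ordLine (W.baseChange K) p κ 1 𝔓) (hw0 : w ≠ 0)
    (hlam : IsUnit (PowerSeries.constantCoeff (B.lam 1 n))) : B.kappa 1 (n * q) 0 ≠ 0 := by
  intro h0
  apply ordLoc_kappa_ne_zero_of_isUnit_lam hB hnq hq hqn hv h𝔓 hw hw0 hlam
  rw [ordLoc_apply_zero, h0, map_zero]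

/-- **The edge `n — nq` read both ways: `λ_1(n)(0) ∈ ℤ_pˣ ⟺ ordLoc_𝔓(κ_1(nq))_0(0) ≠ 0`** (given a non-zero element of the ordinary line
at `𝔓`): g19's `isUnit_constantCoeff_lam_of_ordLoc_ne_zero` and §3. [cite: Howard2006, Lem. 2.3.4, Thm. 3.2.3 (c)]
[cite: CastellaEtAl2025, Thm. 7.4 first law] -/
theorem isUnit_lam_iff_ordLoc_kappa_ne_zero (hB : IsSignedBipartiteSystem W K p κ γ N ε B) {n q : ℕ}
    (hnq : n * q ∈ indefProducts N K (fun ℓ ↦ W.frobeniusTrace ℓ) p 1)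
    (hq : IsAdmissiblePrime N K (fun ℓ ↦ W.frobeniusTrace ℓ) p 1 q) (hqn : ¬ q ∣ n)
    {v : HeightOneSpectrum (𝓞 K)} (hv : ((q : ℕ) : 𝓞 K) ∈ v.asIdeal) {𝔓 : Ideal (absIntegers (𝓞 K) K)}
    (h𝔓 : 𝔓 ∈ v.primesAbove)
    {w : subgroupH1 (𝔓.inertia (absoluteGaloisGroup K) ⊓ κ.kerSubgroup) (geomTorsion (W.baseChange K) ((p : ℤ) ^ 1))}
    (hw : w ∈ ordLine (W.baseChange K) p κ 1 𝔓) (hw0 : w ≠ 0) :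
    IsUnit (PowerSeries.constantCoeff (B.lam 1 n)) ↔ ordLoc (W.baseChange K) p κ γ 1 𝔓 (B.kappa 1 (n * q)) 0 0 ≠ 0 :=
  ⟨ordLoc_kappa_ne_zero_of_isUnit_lam hB hnq hq hqn hv h𝔓 hw hw0,
    fun hne ↦ isUnit_constantCoeff_lam_of_ordLoc_ne_zero hB hnq hq hqn hv h𝔓 hne⟩

end FirstLaw

end Summit.BirchSwinnertonDyer.BirchSwinnertonDyer.Theorems.SignedBaseChangeAcDivAdmdefBipartitePropagation

end
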